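import Summits.CriticalPhenomena.PercolationContinuityZ3.Theorems.PercNearOneGluingNoHeavyQuantGateMoveBlobDatum
import Summits.CriticalPhenomena.PercolationContinuityZ3.Theorems.PercNearOneGluingNoHeavyQuantCornerWitness
import Summits.CriticalPhenomena.PercolationContinuityZ3.Theorems.PercNearOneGluingNoHeavyQuantCornerLayerRestrict
import HarnessLib

/-!
# QUANT lane R8, T-DEC, leg (III): the blob gate move (M) from the CORNER datum — a corner leftover propagates downwards, hence (M)
# for a `t`-low blob atom under ONE residual hypothesis on the unshifted atoms below the blob (typer g28, part 3)

builds on p205010 (kernel theorem, internal audit signed; external expert review pending)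

Support file (`--supports stmt-CriticalPhenomena-4575`), QUANT lane typer seat prim-quant-stmt (gen 28), rung R8 of
`run/shared/lean/prim/quant/LADDER.md`.  Theorems only, standard axioms, no sorries, no definitions.  Parts 1–2: `…QuantLowToZeroMove`
(datum-form criteria), `…QuantGateMoveBlobDatum` ((M) from a datum with the dichotomy).  Corner run: typer g23 (`…QuantCornerRun/Sound/
Theorem/LayerRestrict`), lead g23 (`…QuantCornerWitness`: the named witness `cornerWitness` = corner flow into the mids + leftovers spread
over the giants).

* **`LawDec.cornerMidFlow_eq_zero_of_leftover`** — THRESHOLD STRUCTURE OF THE CORNER RUN: if a low `l` keeps a positive leftover then every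
  smaller row `l′ < l` receives nothing from the mids (at each admissible mid the row `l` was capacity-limited — it still had mass afterwards —
  so the column is saturated by the rows `≥ l`, `cornerMidFlow_char`); `cornerLeftover_eq_of_leftover_above` (the smaller low is entirely
  giant-bound); `cornerWitness_giant_sum` / `cornerWitness_giant_eq_zero` (the giant part of a row of the corner witness is its leftover).
* **`LawDec.flowAtT_gateMoveBlob_of_corner`**, **`LawDec.decAtT_gateMoveBlob_of_corner`** — typer g27's setting of (M) with the blob atom `a`
  a `t`-low (`a ≤ j < M + a`, `2a < t`), hypothesis `slice ν a g ∈ D_y(S + ag, j)`, and instead of `hsupp` the single residual hypothesis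
  `hk`: in the corner run of the slice at `(y, S + ag, j)` no unshifted atom `0 < k < a` that is a `t`-low keeps a positive leftover unless
  the atom `a` keeps a leftover `≥ gz`.  Conclusion: the moved law is `FlowAtT` / `DECAtT` at `(y, S + ag − zag, j)`.  Proof: the corner
  witness is the datum of part 2; a leftover above `a` makes `a` entirely giant-bound (first branch, `slice ν a g a ≥ g ν0 ≥ gz`); otherwise
  every nonzero `t`-low `≠ a` has leftover `0` (above `a` by the threshold structure, below `a` by `hk`) — second branch.
  COVERS: `a = 1` (vacuous `hk`; = typer g27's `sdecUpTo_slice_relay` case), `hsupp` (no unshifted mass below `a`), and every `ν` whose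
  unshifted atoms below `a` are mid-absorbed by the corner run.  OPEN: sub-case (b′) — an unshifted atom below `a` giant-bound while `a` is
  not; the same construction succeeds in every exact test (memo `run/shared/lean/prim/quant/prim-quant-stmt-g28/GATE-MOVE-G28.md` §3: one
  explicit inequality).  HONEST STATUS: (M) ∀ a, `GateMove`, `GatedConvEmptyFree`, `SingleGateConvClosed`, `SDECConvClosed`, `TreeDEC`,
  `FarTreeRow` remain OPEN.

[this work]; corner run typer g23 / lead g21–g23, (M) typer g27 (this lane).  Corner (north-west) rules for Monge transportation arrays are
classical (Hoffman 1963); nothing here is cited as a published result.  The gluing rows served [cite: KozmaNitzan2024, Conjecture 3 (p. 15)];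
product measure [cite: Grimmett1999, §1.3 p. 10].
-/

noncomputable section

namespace Summit.CriticalPhenomena.PercolationContinuityZ3.Theorems

namespace Quant

open Finset

namespace LawDec

/-! ### The corner datum: a leftover propagates downwards -/

section Corner

variable (x T : ℝ) (j' M : ℕ) (μ : ℕ → ℝ)

/-- **A CORNER LEFTOVER PROPAGATES DOWNWARDS.**  In the corner run (`0 < x < 1`, `μ ≥ 0`), if a low `l ≤ j′` (`2l < T`) keeps a positive
leftover, then every smaller row `l′ < l` receives nothing from the mids: at each of its admissible mids the row `l` was capacity-limited
(it still had mass afterwards), so the column is saturated by the rows `≥ l` before the row `l′` is treated. [this work] -/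
theorem cornerMidFlow_eq_zero_of_leftover (hx0 : 0 < x) (hx1 : x < 1) (hμ : ∀ k, 0 ≤ μ k) (l l' h : ℕ) (hl : l ≤ j')
    (hlow : 2 * (l : ℝ) < T) (hll : l' < l) (hleft : 0 < cornerLeftover x T j' M μ l) :
    cornerMidFlow x T j' M μ l' h = 0 := by
  classical
  obtain ⟨hF0, hsup, hrow, hcol⟩ := cornerFlow_inv x T j' M μ hx0 hx1 hμ ((j' + 1) * (j' + 1)) le_rfl
  have hF0' : ∀ a b, 0 ≤ cornerMidFlow x T j' M μ a b := fun a b => hF0 a b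
  have hterm0 : ∀ a b, 0 ≤ usage x T j' a b * cornerMidFlow x T j' M μ a b := fun a b => by
    by_cases hz : cornerMidFlow x T j' M μ a b = 0
    · rw [hz, mul_zero]
    · obtain ⟨-, -, r3, -, r5, -⟩ := hsup a b hz
      have hab : a < b := by
        by_contra hge; push Not at hge
        have : (b : ℝ) ≤ a := by exact_mod_cast hge
        linarith
      exact mul_nonneg (usage_pos_of_compat x T j' a b hx0 hx1 r3 hab (Or.inr r5)).le (hF0 a b)
  by_cases hhj : j' < h
  · exact cornerMidFlow_eq_zero_of x T j' M μ hx0 hx1 hμ l' h (Or.inr hhj)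
  have hh : h ≤ j' := not_lt.1 hhj
  have hl' : l' ≤ j' := by omega
  have hch' := cornerMidFlow_char x T j' M μ hx0 hx1 hμ l' h hl' hh
  by_cases hadm' : 2 * (l' : ℝ) < T ∧ h ≤ M ∧ T < (l' : ℝ) + h
  swap
  · rw [hch', if_neg hadm']
  rw [if_pos hadm'] at hch'
  have hll' : (l' : ℝ) < l := by exact_mod_cast hll
  have hadm : 2 * (l : ℝ) < T ∧ h ≤ M ∧ T < (l : ℝ) + h := ⟨hlow, hadm'.2.1, by linarith [hadm'.2.2]⟩
  have hlh : l < h := by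
    by_contra hge; push Not at hge
    have : (h : ℝ) ≤ l := by exact_mod_cast hge
    linarith [hadm.2.2]
  have hupos : 0 < usage x T j' l h := usage_pos_of_compat x T j' l h hx0 hx1 hlow hlh (Or.inr hadm.2.2)
  have hupos' : 0 < usage x T j' l' h :=
    usage_pos_of_compat x T j' l' h hx0 hx1 hadm'.1 (by omega) (Or.inr hadm'.2.2)
  -- the row `l` at `h`: capacity-limited, since `l` keeps a leftover
  have hchl := cornerMidFlow_char x T j' M μ hx0 hx1 hμ l h hl hh
  rw [if_pos hadm] at hchl
  set A := μ l - ∑ h'' ∈ Finset.range (M + 1), (if h'' < h then cornerMidFlow x T j' M μ l h'' else 0) with hA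
  set B := μ h - ∑ l'' ∈ Finset.range (j' + 1),
    (if l < l'' then usage x T j' l'' h * cornerMidFlow x T j' M μ l'' h else 0) with hB
  have hsplit : ∑ h'' ∈ Finset.range (M + 1), cornerMidFlow x T j' M μ l h''
      ≥ ∑ h'' ∈ Finset.range (M + 1), (if h'' < h then cornerMidFlow x T j' M μ l h'' else 0)
        + cornerMidFlow x T j' M μ l h := by
    have e : ∀ h'', cornerMidFlow x T j' M μ l h''
        = (if h'' < h then cornerMidFlow x T j' M μ l h'' else 0) + (if h ≤ h'' then cornerMidFlow x T j' M μ l h'' else 0) := by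
      intro h''
      by_cases c : h'' < h
      · rw [if_pos c, if_neg (by omega), add_zero]
      · rw [if_neg c, if_pos (not_lt.1 c), zero_add]
    rw [Finset.sum_congr rfl (fun h'' _ => e h''), Finset.sum_add_distrib]
    have hle := Finset.single_le_sum (f := fun h'' => (if h ≤ h'' then cornerMidFlow x T j' M μ l h'' else 0))
      (fun h'' _ => by
        show 0 ≤ (if h ≤ h'' then cornerMidFlow x T j' M μ l h'' else 0)
        split_ifs
        · exact hF0' l h''
        · exact le_rfl)
      (Finset.mem_range.2 (Nat.lt_succ_of_le hadm.2.1))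
    have eh : (if h ≤ h then cornerMidFlow x T j' M μ l h else 0) = cornerMidFlow x T j' M μ l h := if_pos le_rfl
    rw [eh] at hle
    linarith
  have hltA : cornerMidFlow x T j' M μ l h < A := by
    unfold cornerLeftover at hleft
    rw [hA]; linarith
  have hcap : usage x T j' l h * cornerMidFlow x T j' M μ l h = B := by
    have hmin : cornerMidFlow x T j' M μ l h = min A (B / usage x T j' l h) := hchl
    rcases min_choice A (B / usage x T j' l h) with hm | hm
    · rw [hm] at hmin; linarith
    · rw [hm] at hmin
      rw [hmin, mul_div_cancel₀ _ hupos.ne']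
  -- the row `l′` at `h`: no capacity is left
  set B' := μ h - ∑ l'' ∈ Finset.range (j' + 1),
    (if l' < l'' then usage x T j' l'' h * cornerMidFlow x T j' M μ l'' h else 0) with hB'
  have hB'le : B' ≤ 0 := by
    have e : ∀ l'', (if l' < l'' then usage x T j' l'' h * cornerMidFlow x T j' M μ l'' h else 0)
        = (if l < l'' then usage x T j' l'' h * cornerMidFlow x T j' M μ l'' h else 0)
          + (if l'' = l then usage x T j' l'' h * cornerMidFlow x T j' M μ l'' h else 0)
          + (if l' < l'' ∧ l'' < l then usage x T j' l'' h * cornerMidFlow x T j' M μ l'' h else 0) := by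
      intro l''
      by_cases c1 : l < l''
      · rw [if_pos (by omega), if_pos c1, if_neg (by omega), if_neg (by omega)]; ring
      · by_cases c2 : l'' = l
        · rw [if_pos (by omega), if_neg c1, if_pos c2, if_neg (by omega)]; ring
        · by_cases c3 : l' < l''
          · rw [if_pos c3, if_neg c1, if_neg c2, if_pos ⟨c3, by omega⟩]; ring
          · rw [if_neg c3, if_neg c1, if_neg c2, if_neg (fun c => c3 c.1)]; ring
    have hsum : ∑ l'' ∈ Finset.range (j' + 1),
        (if l' < l'' then usage x T j' l'' h * cornerMidFlow x T j' M μ l'' h else 0)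
        ≥ ∑ l'' ∈ Finset.range (j' + 1),
          (if l < l'' then usage x T j' l'' h * cornerMidFlow x T j' M μ l'' h else 0)
          + usage x T j' l h * cornerMidFlow x T j' M μ l h := by
      rw [Finset.sum_congr rfl (fun l'' _ => e l''), Finset.sum_add_distrib, Finset.sum_add_distrib,
        Finset.sum_ite_eq' (Finset.range (j' + 1)) l, if_pos (Finset.mem_range.2 (Nat.lt_succ_of_le hl))]
      have h3 : 0 ≤ ∑ l'' ∈ Finset.range (j' + 1),
          (if l' < l'' ∧ l'' < l then usage x T j' l'' h * cornerMidFlow x T j' M μ l'' h else 0) :=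
        Finset.sum_nonneg fun l'' _ => by
          split_ifs
          · exact hterm0 l'' h
          · exact le_rfl
      linarith
    rw [hB']
    have : B = usage x T j' l h * cornerMidFlow x T j' M μ l h := hcap.symm
    rw [hB] at this
    linarith
  have hle : cornerMidFlow x T j' M μ l' h ≤ B' / usage x T j' l' h := by rw [hch']; exact min_le_right _ _
  have hdiv : B' / usage x T j' l' h ≤ 0 := div_nonpos_of_nonpos_of_nonneg hB'le hupos'.le
  linarith [hF0' l' h]

/-- **hence a low with a leftover forces every smaller low to be entirely giant-bound**: its leftover is its whole mass. [this work] -/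
theorem cornerLeftover_eq_of_leftover_above (hx0 : 0 < x) (hx1 : x < 1) (hμ : ∀ k, 0 ≤ μ k) (l l' : ℕ) (hl : l ≤ j')
    (hlow : 2 * (l : ℝ) < T) (hll : l' < l) (hleft : 0 < cornerLeftover x T j' M μ l) :
    cornerLeftover x T j' M μ l' = μ l' := by
  unfold cornerLeftover
  rw [Finset.sum_eq_zero (fun h _ => cornerMidFlow_eq_zero_of_leftover x T j' M μ hx0 hx1 hμ l l' h hl hlow hll hleft), sub_zero]

/-- the giant part of a row of the corner witness is its leftover (when there is giant mass). -/
theorem cornerWitness_giant_sum (hx0 : 0 < x) (hx1 : x < 1) (hμ : ∀ k, 0 ≤ μ k) (l : ℕ) (hl : l ≤ j')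
    (hlow : 2 * (l : ℝ) < T) (hG : (∑ h ∈ Finset.Ico (j' + 1) (M + 1), μ h) ≠ 0) :
    ∑ h ∈ Finset.Ico (j' + 1) (M + 1), cornerWitness x T j' M μ l h = cornerLeftover x T j' M μ l := by
  set G := ∑ h ∈ Finset.Ico (j' + 1) (M + 1), μ h with hGdef
  have e : ∀ h ∈ Finset.Ico (j' + 1) (M + 1), cornerWitness x T j' M μ l h = (1 / G * cornerLeftover x T j' M μ l) * μ h := by
    intro h hh
    obtain ⟨h1, h2⟩ := Finset.mem_Ico.1 hh
    unfold cornerWitness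
    rw [cornerMidFlow_eq_zero_of x T j' M μ hx0 hx1 hμ l h (Or.inr (by omega)), zero_add, ← hGdef, if_neg hG,
      if_pos (show l ≤ j' ∧ 2 * (l : ℝ) < T from ⟨hl, hlow⟩), if_pos (show j' + 1 ≤ h ∧ h ≤ M by omega)]
  rw [Finset.sum_congr rfl e, ← Finset.mul_sum, ← hGdef]
  field_simp

/-- the giant part of a row of the corner witness vanishes when the row has no leftover. -/
theorem cornerWitness_giant_eq_zero (l h : ℕ) (hh : j' + 1 ≤ h) (hx0 : 0 < x) (hx1 : x < 1) (hμ : ∀ k, 0 ≤ μ k)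
    (hleft : cornerLeftover x T j' M μ l = 0) : cornerWitness x T j' M μ l h = 0 := by
  unfold cornerWitness
  rw [cornerMidFlow_eq_zero_of x T j' M μ hx0 hx1 hμ l h (Or.inr (by omega)), zero_add]
  by_cases hc : l ≤ j' ∧ 2 * (l : ℝ) < T
  · rw [if_pos hc, hleft]; ring
  · rw [if_neg hc]; ring

end Corner

/-! ### (M) from the corner datum -/

/-- **THE BLOB GATE MOVE FROM THE CORNER DATUM (`a` a `t`-low).**  Setting of `flowAtT_gateMoveBlob_of_datum`; hypothesis: the slice is
DEC at `(y, S + ag, j)`, and in its CORNER RUN no unshifted atom strictly between `0` and `a` keeps a positive leftover unless the atom `a`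
keeps a leftover `≥ gz` (`hk`).  Then the moved law has a flow at `(y, t, j)`.  The corner witness is the datum: if a low above `a` keeps a
leftover, `a` is entirely giant-bound (`cornerLeftover_eq_of_leftover_above`, `slice ν a g a ≥ g·ν 0 ≥ gz`) — first branch; otherwise every
nonzero `t`-low `≠ a` has leftover `0` (by `hk` below `a`) — second branch.  Covers `a = 1` and typer g27's `hsupp` (no unshifted atom
below `a` carries mass, so none keeps a leftover). [this work] -/
theorem flowAtT_gateMoveBlob_of_corner (y z g S : ℝ) (a j M : ℕ) (ν : ℕ → ℝ)
    (hy0 : 0 < y) (hy1 : y < 1) (hz0 : 0 ≤ z) (hg1 : g ≤ 1) (hyg : y ≤ (1 - z) * g) (ha : 1 ≤ a)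
    (hν0 : ∀ h, 0 ≤ ν h) (hνM : ∀ h, M < h → ν h = 0) (hν1 : ∑ h ∈ Finset.range (M + 1), ν h = 1)
    (hS : S = ∑ h ∈ Finset.range (M + 1), (h : ℝ) * ν h) (hta : y * (M : ℝ) ≤ S) (hzν : z ≤ ν 0)
    (hjN : j < M + a) (haj : a ≤ j) (hat : 2 * (a : ℝ) < S + (a : ℝ) * g - z * (a : ℝ) * g)
    (hΛ : DECAtT y (S + (a : ℝ) * g) j (M + a) (slice ν a g))
    (hk : ∀ k, 1 ≤ k → k < a → 2 * (k : ℝ) < S + (a : ℝ) * g - z * (a : ℝ) * g →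
      0 < cornerLeftover y (S + (a : ℝ) * g) j (M + a) (slice ν a g) k →
      g * z ≤ cornerLeftover y (S + (a : ℝ) * g) j (M + a) (slice ν a g) a) :
    FlowAtT y (S + (a : ℝ) * g - z * (a : ℝ) * g) j (M + a)
      (fun h => slice ν a g h + g * z * ((if h = 0 then (1 : ℝ) else 0) - (if h = a then (1 : ℝ) else 0))) := by
  set τ : ℝ := S + (a : ℝ) * g with hτ
  set t : ℝ := S + (a : ℝ) * g - z * (a : ℝ) * g with ht
  set Λ : ℕ → ℝ := slice ν a g with hΛdef
  have hz1 : z ≤ 1 := by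
    have h0 := Finset.single_le_sum (fun h _ => hν0 h) (Finset.mem_range.2 (Nat.succ_pos M))
    rw [hν1] at h0
    exact hzν.trans h0
  have hg0 : 0 < g := by
    by_contra hc
    have : (1 - z) * g ≤ 0 := mul_nonpos_of_nonneg_of_nonpos (by linarith) (not_lt.1 hc)
    linarith
  have ha0 : (0 : ℝ) < a := by exact_mod_cast ha
  have hzag : 0 ≤ z * (a : ℝ) * g := mul_nonneg (mul_nonneg hz0 ha0.le) hg0.le
  have htτ : t ≤ τ := by rw [ht, hτ]; linarith
  have haτ : 2 * (a : ℝ) < τ := lt_of_lt_of_le hat htτ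
  have hΛ0 : ∀ h, 0 ≤ Λ h := fun h => slice_nonneg ν a g hg0.le hg1 hν0 h
  have hgzΛa : g * z ≤ Λ a := by
    show g * z ≤ slice ν a g a
    rw [slice_apply_self]; nlinarith [hν0 a, mul_le_mul_of_nonneg_left hzν hg0.le]
  -- the corner witness
  have hC : CornerSucceeds y τ j (M + a) Λ :=
    cornerSucceeds_of_flowAtT y τ j (M + a) Λ hy0 hy1 hΛ0 (flowAtT_of_decAtT y τ j (M + a) Λ hy0 hy1 hΛ)
  have hf : IsFlowAtT y τ j (M + a) Λ (cornerWitness y τ j (M + a) Λ) := isFlowAtT_cornerWitness y τ j (M + a) Λ hy0 hy1 hΛ0 hC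
  refine flowAtT_gateMoveBlob_of_datum y z g S a j M ν (cornerWitness y τ j (M + a) Λ) hy0 hy1 hz0 hg1 hyg ha hν0 hνM hν1 hS
    hta hzν hjN haj hat hf ?_
  -- the dichotomy
  by_cases hG : (∑ h ∈ Finset.Ico (j + 1) (M + a + 1), Λ h) = 0
  · -- no giant mass: every giant entry of the witness vanishes
    refine Or.inr fun l h _ _ _ _ hh => ?_
    unfold cornerWitness
    rw [cornerMidFlow_eq_zero_of y τ j (M + a) Λ hy0 hy1 hΛ0 l h (Or.inr (by omega)), zero_add, if_pos hG]
    ring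
  by_cases hGa : g * z ≤ cornerLeftover y τ j (M + a) Λ a
  · left
    rw [cornerWitness_giant_sum y τ j (M + a) Λ hy0 hy1 hΛ0 a haj haτ hG]
    exact hGa
  · right
    intro l h hl1 hla hlj hlt hh
    apply cornerWitness_giant_eq_zero y τ j (M + a) Λ l h hh hy0 hy1 hΛ0
    -- the leftover of `l` vanishes: otherwise `a` would keep `≥ gz`
    obtain ⟨-, -, hrow, -⟩ := cornerFlow_inv y τ j (M + a) Λ hy0 hy1 hΛ0 ((j + 1) * (j + 1)) le_rfl
    have hleft0 : 0 ≤ cornerLeftover y τ j (M + a) Λ l := by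
      unfold cornerLeftover cornerMidFlow; linarith [hrow l]
    by_contra hne
    have hpos : 0 < cornerLeftover y τ j (M + a) Λ l := lt_of_le_of_ne hleft0 (Ne.symm hne)
    apply hGa
    rcases lt_or_gt_of_ne hla with hlt' | hgt
    · exact hk l hl1 hlt' hlt hpos
    · rw [cornerLeftover_eq_of_leftover_above y τ j (M + a) Λ hy0 hy1 hΛ0 l a hlj (by linarith) hgt hpos]
      exact hgzΛa

/-- **(M) FROM THE CORNER DATUM, DEC form.** [this work] -/
theorem decAtT_gateMoveBlob_of_corner (y z g S : ℝ) (a j M : ℕ) (ν : ℕ → ℝ)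
    (hy0 : 0 < y) (hy1 : y < 1) (hz0 : 0 ≤ z) (hg1 : g ≤ 1) (hyg : y ≤ (1 - z) * g) (ha : 1 ≤ a)
    (hν0 : ∀ h, 0 ≤ ν h) (hνM : ∀ h, M < h → ν h = 0) (hν1 : ∑ h ∈ Finset.range (M + 1), ν h = 1)
    (hS : S = ∑ h ∈ Finset.range (M + 1), (h : ℝ) * ν h) (hta : y * (M : ℝ) ≤ S) (hzν : z ≤ ν 0)
    (hjN : j < M + a) (haj : a ≤ j) (hat : 2 * (a : ℝ) < S + (a : ℝ) * g - z * (a : ℝ) * g)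
    (hΛ : DECAtT y (S + (a : ℝ) * g) j (M + a) (slice ν a g))
    (hk : ∀ k, 1 ≤ k → k < a → 2 * (k : ℝ) < S + (a : ℝ) * g - z * (a : ℝ) * g →
      0 < cornerLeftover y (S + (a : ℝ) * g) j (M + a) (slice ν a g) k →
      g * z ≤ cornerLeftover y (S + (a : ℝ) * g) j (M + a) (slice ν a g) a) :
    DECAtT y (S + (a : ℝ) * g - z * (a : ℝ) * g) j (M + a)
      (fun h => slice ν a g h + g * z * ((if h = 0 then (1 : ℝ) else 0) - (if h = a then (1 : ℝ) else 0))) := by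
  have hg0 : 0 < g := by
    have hz1 : z ≤ 1 := by
      have h0 := Finset.single_le_sum (fun h _ => hν0 h) (Finset.mem_range.2 (Nat.succ_pos M))
      rw [hν1] at h0
      exact hzν.trans h0
    by_contra hc
    have : (1 - z) * g ≤ 0 := mul_nonpos_of_nonneg_of_nonpos (by linarith) (not_lt.1 hc)
    linarith
  obtain ⟨_, hPM, hP1, _⟩ := moved_laws ν a M g z ha hg0.le hg1 hz0 hzν hν0 hνM hν1
  exact decAtT_of_flowAtT y _ j (M + a) _ hy0 hy1 hPM hP1
    (flowAtT_gateMoveBlob_of_corner y z g S a j M ν hy0 hy1 hz0 hg1 hyg ha hν0 hνM hν1 hS hta hzν hjN haj hat hΛ hk)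

end LawDec

end Quant

end Summit.CriticalPhenomena.PercolationContinuityZ3.Theorems
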